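import Literature.MathematicalPhysics.QuantumFieldTheory.Chatterjee2026YMHiggs.U1HiggsScalingLimit
import Literature.MathematicalPhysics.QuantumFieldTheory.Chatterjee2026YMHiggs.SU2UnitaryGaugeDensity
import Literature.MathematicalPhysics.QuantumFieldTheory.ConstructiveQFTWave0Proofs
import Literature.MathematicalPhysics.QuantumLattice.SU2Haar
import HarnessLib

/-!
# The law of the unitary-gauge field: proofs of Chatterjee's Lemmas 5.3 (`U(1)`) and 5.4 (`SU(2)`)

S. Chatterjee, *A scaling limit of `SU(2)` lattice Yang–Mills–Higgs theory*, Probab. Math. Phys.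
**7** (2026) 339–381, arXiv:2401.10507 [Chatterjee2026YMHiggs], §5.2 (arXiv v4 numbering).
This file DISCHARGES the two named facts of the statement files
`Chatterjee2026YMHiggs.U1HiggsScalingLimit` and `Chatterjee2026YMHiggs.SU2UnitaryGaugeDensity`
(D-0014; the defs stay, consumers feed the `_holds` theorems):

* `u1UnitaryGauge_law_holds : u1UnitaryGauge_law` (**Lemma 5.3**): the push-forward of the full
  `U(1)` Yang–Mills–Higgs measure `μ` on `U(1)^E × (S¹)^Λ` under unitary gauge fixing
  `V_e = φ_x^* U_e φ_y` is the unitary-gauge measure with density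
  `exp (g⁻² ∑ₚ Re U_p + α² ∑ₑ Re U_e)`;
* `su2UnitaryGauge_law_holds : su2UnitaryGauge_law` (**Lemma 5.4**): the same for the `SU(2)`
  theory with the Higgs field in the fundamental representation (in the tree's Higgs-frame
  coordinates `φ_x = h_x e₁`, `V_e = h_x⁻¹ U_e h_y`), the image being `su2HiggsMeasure` with
  density `exp ((2g²)⁻¹ ∑ₚ Re tr U_p + (α²/2) ∑ₑ Re tr U_e)`.

## The printed proof, and how it is followed

§5.2, proof of Lemma 5.3: "for fixed `φ`, the map `U ↦ g(U, φ)` [`g(U, φ)_e = φ_x^* U_e φ_y`]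
preserves the product Haar measure on `Σ`", "`S(U, φ) = S(g(U, φ), 1)`" [the Wilson part of the
action is gauge invariant and the Higgs edge term becomes `α² ∑ₑ Re V_e`], then integrate out
`φ`; Lemma 5.4 "is similar", with `Re(e₁^* A e₁) = Re A₁₁ = ½ Re tr A` for `A ∈ SU(2)`. Here:

1. `(U, φ) ↦ g(U, φ)` is the gauge transformation by `φ⁻¹` (`gaugeTransform φ⁻¹ U`), so for
   fixed `φ` it preserves every gauge-invariant measure on `G^E`, in particular the Wilson weight
   `exp(−β S) ∏ₑ dU_e` (`wilsonWeight_map_gaugeTransform`, from the tree's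
   `WilsonGauge.map_gaugeTransform_withDensity` and `wilsonAction_gaugeTransform`); integrating
   `φ` out against ANY probability law of the Higgs frames gives
   `map_prod_eq_of_forall_eq_gaugeTransform` (Fubini in the form `Measure.prod_apply_symm`).
2. The Higgs edge density of `μ` is the pull-back along `g` of the unitary-gauge edge density
   (`U(1)`: `φ_x^* = φ_x⁻¹` on the circle, `Circle.coe_inv_eq_conj`; `SU(2)`:
   `fundamentalRep_two_trace_re`, `Re tr A = 2 Re A₁₁` from `su2_apply_11`), and a density that
   is a pull-back is transported by `map_withDensity_comp`
   (`(w ∘ T) · ν ∘ T⁻¹ = w · (ν ∘ T⁻¹)`).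
3. Normalisations agree because the total masses agree (`map_normalize_of_map_eq`).

No continuity of the densities in `g`, `α` and no positivity of `g`, `α` is used (the printed
standing hypotheses `g, α > 0` are carried by the facts and simply not needed). Theorems only;
no new definitions, no new named facts.
-/

noncomputable section

open scoped ENNReal
open MeasureTheory Finset
open Literature.MathematicalPhysics.QuantumLattice

namespace Literature.MathematicalPhysics.QuantumFieldTheory.Chatterjee2026YMHiggs

/-! ### Two measure-theoretic transport lemmas -/

/-- **Transport of a pulled-back density.** For a measurable map `T` and a measurable weight `H`
on the target, `((H ∘ T) · μ) ∘ T⁻¹ = H · (μ ∘ T⁻¹)` (change of variables for the lower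
Lebesgue integral, `lintegral_map`). [folklore] -/
private theorem map_withDensity_comp {α β : Type*} [MeasurableSpace α] [MeasurableSpace β]
    (μ : Measure α) {T : α → β} (hT : Measurable T) {H : β → ℝ≥0∞} (hH : Measurable H) :
    (μ.withDensity fun x => H (T x)).map T = (μ.map T).withDensity H := by
  ext s hs
  rw [Measure.map_apply hT hs, withDensity_apply _ (hT hs), withDensity_apply _ hs,
    Measure.restrict_map hT hs, lintegral_map hH hT]

/-- **Normalisations of a measure and of its image agree.** If `μ ∘ T⁻¹ = ν` for a measurable
`T`, then `(μ(univ)⁻¹ μ) ∘ T⁻¹ = ν(univ)⁻¹ ν` (the total masses coincide). [folklore] -/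
private theorem map_normalize_of_map_eq {α β : Type*} [MeasurableSpace α] [MeasurableSpace β]
    {μ : Measure α} {ν : Measure β} {T : α → β} (hT : Measurable T) (h : μ.map T = ν) :
    ((μ Set.univ)⁻¹ • μ).map T = (ν Set.univ)⁻¹ • ν := by
  have huniv : μ Set.univ = ν Set.univ := by
    rw [← h, Measure.map_apply hT MeasurableSet.univ, Set.preimage_univ]
  rw [Measure.map_smul, h, huniv]

/-! ### Unitary gauge fixing integrates the Higgs frames out of a gauge-invariant measure -/

section General

variable {d L : ℕ} {G : Type*} [Group G] [TopologicalSpace G] [IsTopologicalGroup G]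
  [CompactSpace G] [MeasurableSpace G] [BorelSpace G]

omit [CompactSpace G] [MeasurableSpace G] [BorelSpace G] in
/-- Joint continuity of the unitary gauge map `(U, φ) ↦ (e ↦ φ_x⁻¹ U_e φ_y)`, `e = (x, y)`,
`y = x + eᵢ` (finitely many continuous group operations). [folklore] -/
private theorem continuous_unitaryGaugeMap :
    Continuous fun p : GaugeConfig d L G × (Site d L → G) =>
      (fun e => (p.2 e.1)⁻¹ * p.1 e * p.2 (e.1.shift e.2) : GaugeConfig d L G) :=
  continuous_pi fun e =>
    ((((continuous_apply e.1).comp continuous_snd).inv.mul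
      ((continuous_apply e).comp continuous_fst)).mul
      ((continuous_apply (e.1.shift e.2)).comp continuous_snd))

/-- The Wilson weight `exp(−β S(U)) ∏ₑ dU_e` of the torus is invariant under every gauge
transformation (Wilson 1974 §III.B; Seiler LNP 159 §1): the product Haar measure is gauge
invariant (`WilsonGauge.map_gaugeTransform_withDensity`) and so is the action
(`wilsonAction_gaugeTransform`). No continuity of `ρ` is needed. [cite: Wilson1974, §III.B eqs. (3.27)–(3.29)] -/
theorem wilsonWeight_map_gaugeTransform [NeZero L] {N : ℕ} (ρ : G →* Matrix (Fin N) (Fin N) ℂ)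
    (β : ℝ) (γ : Site d L → G) :
    (wilsonWeight (d := d) (L := L) ρ β).map (gaugeTransform γ) = wilsonWeight ρ β := by
  unfold wilsonWeight
  exact WilsonGauge.map_gaugeTransform_withDensity γ _ fun U => by rw [wilsonAction_gaugeTransform]

/-- The Wilson weight is an s-finite measure (a density against the finite product Haar measure;
needed for Fubini). [folklore] -/
private theorem sFinite_wilsonWeight [NeZero L] {N : ℕ} (ρ : G →* Matrix (Fin N) (Fin N) ℂ) (β : ℝ) :
    SFinite (wilsonWeight (d := d) (L := L) ρ β) := by
  unfold wilsonWeight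
  infer_instance

/-- **The heart of Lemmas 5.3/5.4** ("for fixed `φ`, the map `U ↦ g(U, φ)` preserves the product
Haar measure … then integrate out `φ`"), in the generality the argument gives: let `μ₀` be an
s-finite measure on `G^E` invariant under all gauge transformations, `π` ANY probability law of
the Higgs frames `φ ∈ G^Λ`, and `T` a measurable map with `T(U, φ) = U^{φ⁻¹}` (the unitary gauge
map `V_e = φ_x⁻¹ U_e φ_y`). Then `(μ₀ ⊗ π) ∘ T⁻¹ = μ₀`: by Fubini
(`Measure.prod_apply_symm`) `(μ₀ ⊗ π)(T⁻¹ B) = ∫ μ₀((·)^{φ⁻¹} ∈ B) dπ(φ) = ∫ μ₀(B) dπ = μ₀(B)`.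
[cite: Chatterjee2026YMHiggs, §5.2 (proof of Lemma 5.3)] -/
theorem map_prod_eq_of_forall_eq_gaugeTransform [NeZero L] (μ₀ : Measure (GaugeConfig d L G))
    [SFinite μ₀] (hμ : ∀ γ : Site d L → G, μ₀.map (gaugeTransform γ) = μ₀)
    (π : Measure (Site d L → G)) [IsProbabilityMeasure π]
    {T : GaugeConfig d L G × (Site d L → G) → GaugeConfig d L G} (hTm : Measurable T)
    (hT : ∀ (U : GaugeConfig d L G) (φ : Site d L → G), T (U, φ) = gaugeTransform φ⁻¹ U) :
    (μ₀.prod π).map T = μ₀ := by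
  ext s hs
  rw [Measure.map_apply hTm hs, Measure.prod_apply_symm (hTm hs)]
  have hsec : ∀ φ : Site d L → G,
      μ₀ ((fun U : GaugeConfig d L G => (U, φ)) ⁻¹' (T ⁻¹' s)) = μ₀ s := by
    intro φ
    have hset : (fun U : GaugeConfig d L G => (U, φ)) ⁻¹' (T ⁻¹' s) = gaugeTransform φ⁻¹ ⁻¹' s := by
      ext U
      simp only [Set.mem_preimage, hT]
    rw [hset, ← Measure.map_apply (μ := μ₀)
      (WilsonGauge.measurePreserving_gaugeTransform (d := d) (L := L) φ⁻¹).measurable hs, hμ]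
  simp_rw [hsec]
  rw [lintegral_const, measure_univ, mul_one]

/-- **Lemmas 5.3/5.4 at the level of weights**: with `μ₀`, `π`, `T` as in
`map_prod_eq_of_forall_eq_gaugeTransform` and a measurable edge weight `H` on `G^E`, the measure
`(H ∘ T) · (μ₀ ⊗ π)` — the full Yang–Mills–Higgs weight, whose Higgs term `S(U, φ)` is the
unitary-gauge term `H` evaluated at `g(U, φ)` — is pushed by `T` to `H · μ₀`, the unitary-gauge
weight. [cite: Chatterjee2026YMHiggs, §5.2 (proof of Lemma 5.3: "S(U, φ) = S(g(U, φ), 1)")] -/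
theorem map_withDensity_prod_eq_of_forall_eq_gaugeTransform [NeZero L]
    (μ₀ : Measure (GaugeConfig d L G)) [SFinite μ₀]
    (hμ : ∀ γ : Site d L → G, μ₀.map (gaugeTransform γ) = μ₀)
    (π : Measure (Site d L → G)) [IsProbabilityMeasure π]
    {T : GaugeConfig d L G × (Site d L → G) → GaugeConfig d L G} (hTm : Measurable T)
    (hT : ∀ (U : GaugeConfig d L G) (φ : Site d L → G), T (U, φ) = gaugeTransform φ⁻¹ U)
    {H : GaugeConfig d L G → ℝ≥0∞} (hH : Measurable H) :
    ((μ₀.prod π).withDensity fun p => H (T p)).map T = μ₀.withDensity H := by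
  rw [map_withDensity_comp _ hTm hH, map_prod_eq_of_forall_eq_gaugeTransform μ₀ hμ π hTm hT]

end General

/-! ### Lemma 5.3: the `U(1)` theory -/

section U1

variable {d L : ℕ}

/-- The `U(1)` unitary gauge map `(U, φ) ↦ V`, `V_e = φ_x^* U_e φ_y` (§1.3), is (jointly) measurable —
indeed continuous: finitely many group operations. [cite: Chatterjee2026YMHiggs, §1.3 (unitary gauge fixing: the map (U, φ) ↦ V = g(U, φ) of §5.2)] -/
theorem measurable_u1UnitaryGauge [NeZero L] :
    Measurable (u1UnitaryGauge : GaugeConfig d L Circle × (Site d L → Circle) → GaugeConfig d L Circle) :=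
  (continuous_unitaryGaugeMap (G := Circle)).measurable

/-- The `U(1)` unitary gauge map is the gauge transformation by `φ⁻¹`:
`φ_x^* U_e φ_y = (U^{φ⁻¹})_e`. [cite: Chatterjee2026YMHiggs, §1.3 and §5.2 (g(U, φ) = θ(U, φ), θ_x = φ_x^*)] -/
theorem u1UnitaryGauge_eq_gaugeTransform (U : GaugeConfig d L Circle) (φ : Site d L → Circle) :
    u1UnitaryGauge (U, φ) = gaugeTransform φ⁻¹ U := by
  funext e
  simp only [u1UnitaryGauge, gaugeTransform, Pi.inv_apply, inv_inv]

/-- **Lemma 5.3 for the un-normalised weights**: unitary gauge fixing pushes the full `U(1)`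
Yang–Mills–Higgs weight `e^{S(U, φ)} ∏ dU_e ∏ dφ_x` to the unitary-gauge weight
`exp (g⁻² ∑ₚ Re U_p + α² ∑ₑ Re U_e) ∏ dU_e` (same constants, no normalisation).
[cite: Chatterjee2026YMHiggs, Lemma 5.3 (§5.2), proof] -/
theorem u1FullHiggsWeight_map_u1UnitaryGauge [NeZero L] (g α : ℝ) :
    (u1FullHiggsWeight (d := d) L g α).map u1UnitaryGauge = u1HiggsWeight (d := d) L g α := by
  haveI := sFinite_wilsonWeight (d := d) (L := L) (G := Circle) u1Rep (g ^ 2)⁻¹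
  -- the unitary-gauge edge weight `H(V) = exp (α² ∑ₑ Re V_e)`
  have hH : Measurable fun U : GaugeConfig d L Circle =>
      ENNReal.ofReal (Real.exp (α ^ 2 * ∑ e : Edge d L, ((U e : Circle) : ℂ).re)) := by
    refine (ENNReal.continuous_ofReal.comp (Real.continuous_exp.comp
      (continuous_const.mul (continuous_finsetSum _ fun e _ => ?_)))).measurable
    exact Complex.continuous_re.comp (continuous_subtype_val.comp (continuous_apply e))
  -- `S(U, φ) = S(g(U, φ), 1)`: the Higgs term of `μ` is `H` pulled back along the gauge map
  -- (`φ_x^* = φ_x⁻¹` on the circle)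
  have hdens : (fun Uφ : GaugeConfig d L Circle × (Site d L → Circle) =>
      ENNReal.ofReal (Real.exp (α ^ 2 * ∑ e : Edge d L,
        (starRingEnd ℂ ((Uφ.2 e.1 : Circle) : ℂ) * ((Uφ.1 e : Circle) : ℂ) *
          ((Uφ.2 (e.1.shift e.2) : Circle) : ℂ)).re))) =
      fun Uφ => (fun U : GaugeConfig d L Circle =>
        ENNReal.ofReal (Real.exp (α ^ 2 * ∑ e : Edge d L, ((U e : Circle) : ℂ).re)))
        (u1UnitaryGauge Uφ) := by
    funext Uφ
    simp only [u1UnitaryGauge, Circle.coe_mul, Circle.coe_inv_eq_conj]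
  have key : (((wilsonWeight (d := d) (L := L) u1Rep (g ^ 2)⁻¹).prod
        (Measure.pi fun _ : Site d L => haarProbability Circle)).withDensity
        fun Uφ => (fun U : GaugeConfig d L Circle =>
          ENNReal.ofReal (Real.exp (α ^ 2 * ∑ e : Edge d L, ((U e : Circle) : ℂ).re)))
          (u1UnitaryGauge Uφ)).map u1UnitaryGauge =
      (wilsonWeight (d := d) (L := L) u1Rep (g ^ 2)⁻¹).withDensity fun U =>
        ENNReal.ofReal (Real.exp (α ^ 2 * ∑ e : Edge d L, ((U e : Circle) : ℂ).re)) :=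
    map_withDensity_prod_eq_of_forall_eq_gaugeTransform (T := u1UnitaryGauge)
      (H := fun U : GaugeConfig d L Circle =>
        ENNReal.ofReal (Real.exp (α ^ 2 * ∑ e : Edge d L, ((U e : Circle) : ℂ).re)))
      _ (wilsonWeight_map_gaugeTransform u1Rep _) _ measurable_u1UnitaryGauge
      u1UnitaryGauge_eq_gaugeTransform hH
  rw [u1FullHiggsWeight, u1HiggsWeight, hdens]
  exact key

/-- **Lemma 5.3** (Chatterjee), PROVED — discharge of the named fact `u1UnitaryGauge_law`: for the
`U(1)` lattice Yang–Mills–Higgs theory with the degenerate (fixed-length) Higgs potential on the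
torus `(ℤ/Lℤ)ᵈ`, the law of the unitary-gauge field `V_e = φ_x^* U_e φ_y` under
`μ = Z⁻¹ e^{S(U,φ)} ∏ dU_e ∏ dφ_x` has density proportional to
`exp (g⁻² ∑ₚ Re U_p + α² ∑ₑ Re U_e)` against product Haar measure — i.e. is `u1HiggsMeasure L g α`.
Proof as printed (§5.2): `U ↦ g(U, φ)` preserves the Wilson weight for each `φ`,
`S(U, φ) = S(g(U, φ), 1)`, integrate out `φ`, compare normalisations. (Holds for all real
`g, α`; the fact's `g, α > 0` are not used.) [cite: Chatterjee2026YMHiggs, Lemma 5.3 (§5.2); proof ibid.] -/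
theorem u1UnitaryGauge_law_holds : u1UnitaryGauge_law := by
  intro d L _ g α _ _
  unfold u1FullHiggsMeasure u1HiggsMeasure
  exact map_normalize_of_map_eq measurable_u1UnitaryGauge
    (u1FullHiggsWeight_map_u1UnitaryGauge (d := d) (L := L) g α)

end U1

/-! ### Lemma 5.4: the `SU(2)` theory -/

section SU2

variable {d L : ℕ}

/-- `Re tr A = 2 Re A₁₁` for `A ∈ SU(2)` (`A = [[a, b], [−b̄, ā]]`): the identity
`Re(e₁^* A e₁) = ½ Re tr A` of the printed proof of Lemma 5.4, relating the Higgs term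
`α² Re(φ_x^* U_e φ_y)` to the unitary-gauge edge weight `(α²/2) Re tr V_e`. [cite: Chatterjee2026YMHiggs, §5.2 (proof of Lemma 5.4)] -/
theorem fundamentalRep_two_trace_re (V : SU2) :
    ((fundamentalRep (Fin 2) V).trace).re = 2 * ((fundamentalRep (Fin 2) V) 0 0).re := by
  rw [fundamentalRep_apply, Matrix.trace_fin_two, su2_apply_11, Complex.add_re, Complex.conj_re]
  ring

/-- The `SU(2)` unitary gauge map `(U, h) ↦ V`, `V_e = h_x⁻¹ U_e h_y` (§1.4, Higgs frames
`φ_x = h_x e₁`), is (jointly) measurable — indeed continuous (`SU(2)` is second countable,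
`secondCountableTopology_su2`). [cite: Chatterjee2026YMHiggs, §1.4 (unitary gauge fixing θ_x φ_x = e₁: the map (U, φ) ↦ V)] -/
theorem measurable_su2UnitaryGauge [NeZero L] :
    Measurable (su2UnitaryGauge : GaugeConfig d L SU2 × (Site d L → SU2) → GaugeConfig d L SU2) := by
  haveI : SecondCountableTopology SU2 := secondCountableTopology_su2
  exact (continuous_unitaryGaugeMap (G := SU2)).measurable

/-- The `SU(2)` unitary gauge map is the gauge transformation by `h⁻¹` (`θ_x = h_x⁻¹`):
`h_x⁻¹ U_e h_y = (U^{h⁻¹})_e`. [cite: Chatterjee2026YMHiggs, §1.4 and §5.2 (unitary gauge fixing θ_x φ_x = e₁)] -/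
theorem su2UnitaryGauge_eq_gaugeTransform (U : GaugeConfig d L SU2) (h : Site d L → SU2) :
    su2UnitaryGauge (U, h) = gaugeTransform h⁻¹ U := by
  funext e
  simp only [su2UnitaryGauge, gaugeTransform, Pi.inv_apply, inv_inv]

/-- **Lemma 5.4 for the un-normalised weights**: unitary gauge fixing pushes the full `SU(2)`
Yang–Mills–Higgs weight (Higgs frames `φ_x = h_x e₁` with product Haar measure) to the
unitary-gauge weight `su2HiggsWeight L g α` of `ContinuumLimits`, density
`exp ((2g²)⁻¹ ∑ₚ Re tr U_p + (α²/2) ∑ₑ Re tr U_e)`. [cite: Chatterjee2026YMHiggs, Lemma 5.4 (§5.2), proof] -/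
theorem su2FullHiggsWeight_map_su2UnitaryGauge [NeZero L] (g α : ℝ) :
    (su2FullHiggsWeight (d := d) L g α).map su2UnitaryGauge = su2HiggsWeight (d := d) L g α := by
  haveI : SecondCountableTopology SU2 := secondCountableTopology_su2
  haveI := sFinite_wilsonWeight (d := d) (L := L) (G := SU2) (fundamentalRep (Fin 2)) (2 * g ^ 2)⁻¹
  -- the unitary-gauge edge weight `H(V) = exp ((α²/2) ∑ₑ Re tr V_e)`
  have hH : Measurable fun U : GaugeConfig d L SU2 =>
      ENNReal.ofReal (Real.exp (α ^ 2 / 2 *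
        ∑ e : Edge d L, ((fundamentalRep (Fin 2) (U e)).trace).re)) := by
    refine (ENNReal.continuous_ofReal.comp (Real.continuous_exp.comp
      (continuous_const.mul (continuous_finsetSum _ fun e _ => ?_)))).measurable
    exact Complex.continuous_re.comp
      (((continuous_fundamentalRep (Fin 2)).comp (continuous_apply e)).matrix_trace)
  -- `(α²/2) ∑ₑ 2 Re A_e,₁₁ = α² ∑ₑ Re A_e,₁₁`
  have hsum : ∀ f : Edge d L → ℝ, α ^ 2 / 2 * ∑ e : Edge d L, 2 * f e = α ^ 2 * ∑ e, f e := by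
    intro f
    rw [← Finset.mul_sum]
    ring
  -- `S(U, φ) = H(g(U, φ))`: the Higgs term of `μ` is `H` pulled back along the gauge map
  -- (`Re(e₁^* A e₁) = ½ Re tr A` on `SU(2)`)
  have hdens : (fun Uh : GaugeConfig d L SU2 × (Site d L → SU2) =>
      ENNReal.ofReal (Real.exp (α ^ 2 * ∑ e : Edge d L,
        (fundamentalRep (Fin 2) ((Uh.2 e.1)⁻¹ * Uh.1 e * Uh.2 (e.1.shift e.2)) 0 0).re))) =
      fun Uh => (fun U : GaugeConfig d L SU2 =>
        ENNReal.ofReal (Real.exp (α ^ 2 / 2 *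
          ∑ e : Edge d L, ((fundamentalRep (Fin 2) (U e)).trace).re)))
        (su2UnitaryGauge Uh) := by
    funext Uh
    simp only [su2UnitaryGauge, fundamentalRep_two_trace_re, hsum]
  have key : (((wilsonWeight (d := d) (L := L) (fundamentalRep (Fin 2)) (2 * g ^ 2)⁻¹).prod
        (Measure.pi fun _ : Site d L => haarProbability SU2)).withDensity
        fun Uh => (fun U : GaugeConfig d L SU2 =>
          ENNReal.ofReal (Real.exp (α ^ 2 / 2 *
            ∑ e : Edge d L, ((fundamentalRep (Fin 2) (U e)).trace).re)))
          (su2UnitaryGauge Uh)).map su2UnitaryGauge =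
      (wilsonWeight (d := d) (L := L) (fundamentalRep (Fin 2)) (2 * g ^ 2)⁻¹).withDensity fun U =>
        ENNReal.ofReal (Real.exp (α ^ 2 / 2 *
          ∑ e : Edge d L, ((fundamentalRep (Fin 2) (U e)).trace).re)) :=
    map_withDensity_prod_eq_of_forall_eq_gaugeTransform (T := su2UnitaryGauge)
      (H := fun U : GaugeConfig d L SU2 =>
        ENNReal.ofReal (Real.exp (α ^ 2 / 2 *
          ∑ e : Edge d L, ((fundamentalRep (Fin 2) (U e)).trace).re)))
      _ (wilsonWeight_map_gaugeTransform (fundamentalRep (Fin 2)) _) _ measurable_su2UnitaryGauge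
      su2UnitaryGauge_eq_gaugeTransform hH
  rw [su2FullHiggsWeight, su2HiggsWeight, hdens]
  exact key

/-- **Lemma 5.4** (Chatterjee), PROVED — discharge of the named fact `su2UnitaryGauge_law`: for
the `SU(2)` lattice Yang–Mills–Higgs theory with the Higgs field in the fundamental
representation and the degenerate potential (`φ_x ∈ S³`), the law of the unitary-gauge field
`V_e = θ_x U_e θ_y^*` (`θ_x φ_x = e₁`) under `μ` has density proportional to
`exp (g_C⁻² ∑ₚ Re tr U_p + (α_C²/2) ∑ₑ Re tr U_e)` against product Haar measure — in the tree's
dictionary `g_C = √2 g`, `α_C = α`, it is `ContinuumLimits.su2HiggsMeasure L g α`. Proof as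
printed (§5.2, "similar" to Lemma 5.3): gauge invariance of the Wilson weight under
`U ↦ g(U, φ)` for fixed `φ`, `Re(e₁^* A e₁) = ½ Re tr A` on `SU(2)`, integrate out the Higgs
frames, compare normalisations. (Holds for all real `g, α`.) [cite: Chatterjee2026YMHiggs, Lemma 5.4 (§5.2; arXiv v4 numbering, v1: Lemma 5.3); proof ibid.] -/
theorem su2UnitaryGauge_law_holds : su2UnitaryGauge_law := by
  intro d L _ g α _ _
  unfold su2FullHiggsMeasure su2HiggsMeasure
  exact map_normalize_of_map_eq measurable_su2UnitaryGauge
    (su2FullHiggsWeight_map_su2UnitaryGauge (d := d) (L := L) g α)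

end SU2

end Literature.MathematicalPhysics.QuantumFieldTheory.Chatterjee2026YMHiggs
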